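/-
Copyright: pub-rosobs cell (Resolution Observatory), carver gen 39.  Companion file; statements OURS, in
the cell's polynomial weighted-centre model `W(f)`; every public declaration names the published object
it is about.  Instrument / certificate format — NOT a resolution theorem.
-/
import Literature.AlgebraicGeometry.Resolution.WeightedCentreStepUmbrella
import Mathlib.Algebra.CharP.Two
import Mathlib.Algebra.MvPolynomial.Monad
import HarnessLib

/-!
# Kernel replay of umbrella normal forms (`R4`): elementary automorphism words

[cite: AbramovichTemkinWlodarczyk2024, §5.1 (p. 1575) and Thm. 5.3.1 (3) (p. 1578): the invariant
`inv_p(I) = max (a₁, …, a_k)` is taken over ALL regular systems of parameters, so it is unchanged by a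
change of coordinates fixing `p`]; [cite: CossartJannsenSaito2020, Def. 8.2 / Thm. 8.16 (the vertex
preparation coordinate changes `y ↦ y + q(u)`, `q` a polynomial in the other variables)];
[cite: Temkin2025, §1.2.2 warning (1) (Włodarczyk: over `𝔽₂` the Whitney umbrella `x² + y²z` has
multiorder `(2,3,3)` at each closed point of the `z`-axis)].

`WeightedCentreStepUmbrella` proved `max W(X_i^p + X_j^m X_l) = (p, m+1, m+1)` (`isMaxInv_umbrella`).
A germ `G` is CERTIFIED to have the same maximal weighted centre value as soon as one exhibits a
polynomial automorphism `Φ` of `k[X]` fixing the origin with `G = Φ (umbrella)` — by the transport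
theorem `admissibleInvariants_map_eq` (carver g38).  This file supplies

* §1 the **elementary (de Jonquières / vertex-preparation) automorphism** `addPolyShear a q :
  X_a ↦ X_a + q̄`, every other variable fixed, where `q̄ = killVar a q` is `q` with the monomials
  containing `X_a` deleted (so NO side condition is needed; for `q` free of `X_a`, `q̄ = q`,
  `addPolyShear_X_self_of_notMem`).  It is a `k`-algebra automorphism (inverse `X_a ↦ X_a − q̄`) and
  fixes the origin when `q(0) = 0`.  Origin-fixing is stable under composition (`AlgEquiv.trans`).
* §2 `isMaxInv_map_umbrella`: `max W(Φ (X_i^p + X_j^m X_l)) = (p, m+1, m+1)` for every origin-fixing `Φ`.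
* §3 the published instance: over a field of characteristic `2`, `X₀² + X₁²(X₂ + d²)` — the Whitney
  umbrella re-centred at the rational point `z = d²` of its singular axis — has `max W = (2,3,3)`
  (`isMaxInv_whitneyUmbrella_axisPoint`), since it is `addMonomialShear 0 1 d 1 (umbrella)`.
* §4 WORD FORMAT + worked replays.  A *word* is a list of moves `X_v ↦ X_v + r` (`r ∈ k[other
  variables]`, `r(0) = 0`), applied in order, i.e. the automorphism `((E₁.trans E₂).trans …)`; three
  rows of the cell's step census (labels in the comments; data, not literature) are replayed as
  `example`s: the kernel checks `G = word (umbrella)` by expansion in characteristic `p` and concludes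
  `IsMaxInv (W G) [p, m+1, m+1]`.  (All 178 pure-umbrella STALL rows of that census admit such a
  word of length ≤ 2 — checked outside the kernel by the cell's twin script; this file shows the
  kernel side of the format on three of them.)
-/

noncomputable section

open MvPolynomial

namespace Literature.AlgebraicGeometry.Resolution.WeightedBlowup

/-! ## §1 Elementary automorphisms `X_a ↦ X_a + q(other variables)` -/

section PolyShear

variable {σ : Type*} [DecidableEq σ] {K : Type*} [CommRing K]

/-- `killVar a q` = `q` with `X_a ↦ 0`: deletes every monomial of `q` containing `X_a`.
[cite: CossartJannsenSaito2020, Def. 8.2 (polynomials `q(u)` in the variables other than `y`)] -/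
def killVar (a : σ) : MvPolynomial σ K →ₐ[K] MvPolynomial σ K :=
  aeval fun x => if x = a then 0 else X x

/-- `killVar` on a variable. (derived here) [cite: CossartJannsenSaito2020, Def. 8.2] -/
@[simp] theorem killVar_X (a x : σ) :
    killVar a (X x : MvPolynomial σ K) = if x = a then 0 else X x := by
  simp [killVar]

/-- `killVar a q` never involves `X_a`. (derived here) [cite: CossartJannsenSaito2020, Def. 8.2] -/
theorem notMem_vars_killVar (a : σ) (q : MvPolynomial σ K) : a ∉ (killVar a q).vars := by
  intro h
  change a ∈ (aeval (fun x => if x = a then (0 : MvPolynomial σ K) else X x) q).vars at h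
  have h' := vars_bind₁ (fun x => if x = a then (0 : MvPolynomial σ K) else X x) q
  rw [← aeval_eq_bind₁] at h'
  obtain ⟨x, -, hx⟩ := Finset.mem_biUnion.1 (h' h)
  by_cases hxa : x = a
  · simp [hxa] at hx
  · simp only [hxa, if_false] at hx
    rw [vars_def, Multiset.mem_toFinset] at hx
    exact hxa (Multiset.mem_singleton.1 (Multiset.mem_of_le (degrees_X' x) hx)).symm

/-- If `q` is free of `X_a`, nothing is deleted. (derived here) [cite: CossartJannsenSaito2020, Def. 8.2] -/
theorem killVar_eq_self_of_notMem {a : σ} {q : MvPolynomial σ K} (hq : a ∉ q.vars) :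
    killVar a q = q := by
  change (killVar a : MvPolynomial σ K →ₐ[K] MvPolynomial σ K).toRingHom q = RingHom.id _ q
  refine hom_congr_vars ?_ ?_ rfl
  · ext c
    simp [killVar]
  · intro x hx _
    have hxa : x ≠ a := fun h => hq (h ▸ hx)
    simp [killVar, hxa]

/-- `killVar` does not change the constant term. (derived here) [cite: CossartJannsenSaito2020, Def. 8.2] -/
theorem constantCoeff_killVar (a : σ) (q : MvPolynomial σ K) :
    constantCoeff (killVar a q) = constantCoeff q := by
  have h1 : ∀ F : MvPolynomial σ K, constantCoeff F = aeval (fun _ : σ => (0 : K)) F := fun F => by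
    rw [aeval_zero']
    rfl
  rw [h1, h1 q, killVar, ← AlgHom.comp_apply, comp_aeval]
  have hfg : (fun i => (aeval fun _ : σ => (0 : K)) (if i = a then (0 : MvPolynomial σ K) else X i)) =
      fun _ => 0 := by
    funext x
    split_ifs <;> simp
  rw [hfg]

/-- The algebra endomorphism `X_a ↦ X_a + r`, other variables fixed. [cite: CossartJannsenSaito2020,
Def. 8.2 / Thm. 8.16 (coordinate changes `y ↦ y + q(u)` preparing the vertex)] -/
def addPolyShearHom (a : σ) (r : MvPolynomial σ K) : MvPolynomial σ K →ₐ[K] MvPolynomial σ K :=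
  aeval fun x => if x = a then X a + r else X x

/-- `addPolyShearHom` on a variable. (derived here) [cite: CossartJannsenSaito2020, Def. 8.2] -/
@[simp] theorem addPolyShearHom_X (a : σ) (r : MvPolynomial σ K) (x : σ) :
    addPolyShearHom a r (X x) = if x = a then X a + r else X x := by
  simp [addPolyShearHom]

/-- A polynomial free of `X_a` is fixed by `X_a ↦ X_a + r`. (derived here)
[cite: CossartJannsenSaito2020, Def. 8.2] -/
theorem addPolyShearHom_eq_self_of_notMem (a : σ) (r : MvPolynomial σ K) {q : MvPolynomial σ K}
    (hq : a ∉ q.vars) : addPolyShearHom a r q = q := by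
  change (addPolyShearHom a r : MvPolynomial σ K →ₐ[K] MvPolynomial σ K).toRingHom q = RingHom.id _ q
  refine hom_congr_vars ?_ ?_ rfl
  · ext c
    simp [addPolyShearHom]
  · intro x hx _
    have hxa : x ≠ a := fun h => hq (h ▸ hx)
    simp [addPolyShearHom, hxa]

/-- `(X_a ↦ X_a − r) ∘ (X_a ↦ X_a + r) = id` for `r` free of `X_a` (private helper). [folklore] -/
private theorem addPolyShearHom_comp_neg (a : σ) {r : MvPolynomial σ K} (hr : a ∉ r.vars) :
    (addPolyShearHom a (-r)).comp (addPolyShearHom a r) = AlgHom.id K _ := by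
  refine MvPolynomial.algHom_ext fun x => ?_
  by_cases hx : x = a
  · subst hx
    simp [addPolyShearHom_eq_self_of_notMem x (-r) hr]
  · simp [hx]

/-- **The elementary automorphism** `addPolyShear a q : X_a ↦ X_a + killVar a q` (= `X_a + q` when
`q` is free of `X_a`), every other variable fixed; inverse `X_a ↦ X_a − killVar a q`.
[cite: CossartJannsenSaito2020, Def. 8.2 / Thm. 8.16 (vertex-preparation coordinate changes
`y ↦ y + q(u)`)] -/
def addPolyShear (a : σ) (q : MvPolynomial σ K) : MvPolynomial σ K ≃ₐ[K] MvPolynomial σ K :=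
  AlgEquiv.ofAlgHom (addPolyShearHom a (killVar a q)) (addPolyShearHom a (-killVar a q))
    (by
      have h := addPolyShearHom_comp_neg a (r := -killVar a q)
        (by rw [vars_neg]; exact notMem_vars_killVar a q)
      rwa [neg_neg] at h)
    (addPolyShearHom_comp_neg a (notMem_vars_killVar a q))

/-- (derived here) [cite: CossartJannsenSaito2020, Def. 8.2] -/
@[simp] theorem addPolyShear_X_self (a : σ) (q : MvPolynomial σ K) :
    addPolyShear a q (X a) = X a + killVar a q := by
  simp [addPolyShear]

/-- (derived here) [cite: CossartJannsenSaito2020, Def. 8.2] -/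
theorem addPolyShear_X_self_of_notMem (a : σ) {q : MvPolynomial σ K} (hq : a ∉ q.vars) :
    addPolyShear a q (X a) = X a + q := by
  rw [addPolyShear_X_self, killVar_eq_self_of_notMem hq]

/-- (derived here) [cite: CossartJannsenSaito2020, Def. 8.2] -/
@[simp] theorem addPolyShear_X_of_ne (a : σ) (q : MvPolynomial σ K) {x : σ} (hx : x ≠ a) :
    addPolyShear a q (X x) = X x := by
  simp [addPolyShear, hx]

/-- The shear fixes the origin when `q(0) = 0`. (derived here)
[cite: AbramovichTemkinWlodarczyk2024, §5.1 (changes of regular parameters at the point)] -/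
theorem constantCoeff_addPolyShear_X (a : σ) {q : MvPolynomial σ K} (hq : constantCoeff q = 0)
    (x : σ) : constantCoeff (addPolyShear a q (X x)) = 0 := by
  by_cases hx : x = a
  · subst hx
    rw [addPolyShear_X_self, map_add, constantCoeff_X, constantCoeff_killVar, hq, add_zero]
  · rw [addPolyShear_X_of_ne a q hx, constantCoeff_X]

end PolyShear

variable {k : Type*} [Field k] {N : ℕ}

/-- Origin-fixing coordinate changes compose. (derived here)
[cite: AbramovichTemkinWlodarczyk2024, Lemma 5.2.10 (p. 1577)] -/
theorem forall_constantCoeff_trans_X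
    {Φ₁ Φ₂ : MvPolynomial (Fin N) k ≃ₐ[k] MvPolynomial (Fin N) k}
    (h₁ : ∀ x, constantCoeff (Φ₁ (X x)) = 0) (h₂ : ∀ x, constantCoeff (Φ₂ (X x)) = 0) (x : Fin N) :
    constantCoeff ((Φ₁.trans Φ₂) (X x)) = 0 := by
  rw [AlgEquiv.trans_apply]
  exact constantCoeff_map_eq_zero Φ₂ h₂ (h₁ x)

/-! ## §2 Transport of the umbrella value -/

/-- **Any germ that is the umbrella in some regular system of parameters has `max W = (p, m+1, m+1)`.**
(derived here: `admissibleInvariants_map_eq` + `isMaxInv_umbrella`)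
[cite: AbramovichTemkinWlodarczyk2024, §5.1 and Thm. 5.3.1 (3) (independence of coordinates)] -/
theorem isMaxInv_map_umbrella (Φ : MvPolynomial (Fin N) k ≃ₐ[k] MvPolynomial (Fin N) k)
    (hΦ : ∀ x, constantCoeff (Φ (X x)) = 0) {i j l : Fin N} (hij : i ≠ j) (hil : i ≠ l)
    (hjl : j ≠ l) {p m : ℕ} (hp : 2 ≤ p) (hpm : p ≤ m) (hndvd : ¬ p ∣ m + 1) :
    IsMaxInv (admissibleInvariants (Φ (umbrella k i j l p m)))
      [(p : ℚ), ((m + 1 : ℕ) : ℚ), ((m + 1 : ℕ) : ℚ)] := by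
  rw [admissibleInvariants_map_eq Φ hΦ]
  exact isMaxInv_umbrella hij hil hjl hp hpm hndvd

/-! ## §3 The published instance: the Whitney umbrella along its singular axis in characteristic 2 -/

/-- **Włodarczyk's example** [cite: Temkin2025, §1.2.2 warning (1)]: over a field of characteristic `2`
the Whitney umbrella `x² + y²z`, re-centred at the point `z = d²` of its singular axis, i.e.
`X₀² + X₁²·(X₂ + d²)`, still has `max W = (2, 3, 3)` — it is the umbrella in the coordinates
`X₀ ↦ X₀ + d·X₁`.  (Over a perfect field every `c` is a `d²`, so this is every rational point of the
axis; the printed statement is for all closed points over `𝔽₂`.) (derived here) -/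
theorem isMaxInv_whitneyUmbrella_axisPoint (k : Type*) [Field k] [CharP k 2] (d : k) :
    IsMaxInv (admissibleInvariants
      (X 0 ^ 2 + X 1 ^ 2 * (X 2 + C (d ^ 2)) : MvPolynomial (Fin 3) k)) [(2 : ℚ), 3, 3] := by
  have h01 : (1 : Fin 3) ≠ 0 := by decide
  have key : (X 0 ^ 2 + X 1 ^ 2 * (X 2 + C (d ^ 2)) : MvPolynomial (Fin 3) k) =
      addMonomialShear 0 1 h01 d 1 (umbrella k 0 1 2 2 2) := by
    simp only [umbrella, map_add, map_pow, map_mul]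
    rw [addMonomialShear_X_self, addMonomialShear_X_of_ne _ _ _ _ _ h01,
      addMonomialShear_X_of_ne _ _ _ _ _ (show (2 : Fin 3) ≠ 0 by decide), CharTwo.add_sq]
    ring
  have hmax := isMaxInv_map_umbrella (addMonomialShear (0 : Fin 3) 1 h01 d 1)
    (fun x => constantCoeff_addMonomialShear_X _ _ _ _ one_ne_zero x)
    (show (0 : Fin 3) ≠ 1 by decide) (show (0 : Fin 3) ≠ 2 by decide) (show (1 : Fin 3) ≠ 2 by decide)
    (p := 2) (m := 2) le_rfl le_rfl (by decide)
  have e : [(2 : ℚ), 3, 3] = [((2 : ℕ) : ℚ), ((2 + 1 : ℕ) : ℚ), ((2 + 1 : ℕ) : ℚ)] := by norm_num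
  rw [e, key]
  exact hmax

/-! ## §4 Word format and three replayed census rows

A WORD is a list `[(v₁, r₁), …, (v_s, r_s)]`, read as the automorphism
`((addPolyShear v₁ r₁).trans (addPolyShear v₂ r₂)).trans …` — i.e. FIRST substitute `X_{v₁} ↦ X_{v₁} + r₁`
in the umbrella, then `X_{v₂} ↦ X_{v₂} + r₂` in the result, and so on; each `r_t ∈ k[X_x : x ≠ v_t]` with
`r_t(0) = 0`.  A census row `(G; i, j, l, p, m; word)` is REPLAYED by checking `G = word (umbrella k i j l p m)`
(a polynomial identity in characteristic `p`) and concluding `IsMaxInv (W G) [p, m+1, m+1]` from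
`isMaxInv_map_umbrella`.  Variables of the cell's census `(s, y1, y2, y3, y4) = (X 0, …, X 4)`.
The three rows below are data of the cell's step census (their labels are the cell's, not literature). -/

section Replays

/-- abbreviation for the census ring `𝔽_p[s, y₁, y₂, y₃, y₄]`. [folklore] -/
private abbrev R5 (p : ℕ) := MvPolynomial (Fin 5) (ZMod p)

/- Row `CDV#48@p2~id|001` (p, e) = (2, 1): `G = y2²+y2²y3+y1²+s⁴+s⁴y3+s⁴y3⁴+s⁴y3⁵`,
umbrella `(i,j,l) = (y1,y2,y3)`, word `[(y1, y2), (y2, s²+s²y3²)]`, value `(2,3,3)`. -/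
example :
    IsMaxInv (admissibleInvariants
      (X 2 ^ 2 + X 2 ^ 2 * X 3 + X 1 ^ 2 + X 0 ^ 4 + X 0 ^ 4 * X 3 + X 0 ^ 4 * X 3 ^ 4 +
        X 0 ^ 4 * X 3 ^ 5 : R5 2)) [(2 : ℚ), 3, 3] := by
  let Φ : R5 2 ≃ₐ[ZMod 2] R5 2 :=
    (addPolyShear 1 (X 2)).trans (addPolyShear 2 (X 0 ^ 2 + X 0 ^ 2 * X 3 ^ 2))
  have hΦ : ∀ x, constantCoeff (Φ (X x)) = 0 :=
    forall_constantCoeff_trans_X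
      (fun x => constantCoeff_addPolyShear_X _ (by simp [constantCoeff_X]) x)
      (fun x => constantCoeff_addPolyShear_X _ (by simp [constantCoeff_X]) x)
  have key : (X 2 ^ 2 + X 2 ^ 2 * X 3 + X 1 ^ 2 + X 0 ^ 4 + X 0 ^ 4 * X 3 + X 0 ^ 4 * X 3 ^ 4 +
        X 0 ^ 4 * X 3 ^ 5 : R5 2) = Φ (umbrella (ZMod 2) 1 2 3 2 2) := by
    simp only [Φ, umbrella, AlgEquiv.trans_apply, map_add, map_mul, map_pow,
      addPolyShear_X_self, killVar_X, addPolyShear_X_of_ne _ _ (show (2 : Fin 5) ≠ 1 by decide),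
      addPolyShear_X_of_ne _ _ (show (3 : Fin 5) ≠ 1 by decide),
      addPolyShear_X_of_ne _ _ (show (1 : Fin 5) ≠ 2 by decide),
      addPolyShear_X_of_ne _ _ (show (3 : Fin 5) ≠ 2 by decide),
      show ¬ ((2 : Fin 5) = 1) by decide, show ¬ ((0 : Fin 5) = 2) by decide,
      show ¬ ((3 : Fin 5) = 2) by decide, if_false, CharTwo.add_sq, mul_pow, ← pow_mul]
    ring
  have hmax := isMaxInv_map_umbrella Φ hΦ (show (1 : Fin 5) ≠ 2 by decide)
    (show (1 : Fin 5) ≠ 3 by decide) (show (2 : Fin 5) ≠ 3 by decide) (p := 2) (m := 2)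
    le_rfl le_rfl (by decide)
  have e : [(2 : ℚ), 3, 3] = [((2 : ℕ) : ℚ), ((2 + 1 : ℕ) : ℚ), ((2 + 1 : ℕ) : ℚ)] := by norm_num
  rw [e, key]
  exact hmax

/- Row `S4#56@p2~id|010` (p, e) = (2, 2): `G = y3⁴+y2y3⁴+y1²`, umbrella `(i,j,l) = (y1,y3,y2)`, `m = 4`,
word `[(y1, y3²)]`, value `(2,5,5)`. -/
example :
    IsMaxInv (admissibleInvariants (X 3 ^ 4 + X 2 * X 3 ^ 4 + X 1 ^ 2 : R5 2)) [(2 : ℚ), 5, 5] := by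
  let Φ : R5 2 ≃ₐ[ZMod 2] R5 2 := addPolyShear 1 (X 3 ^ 2)
  have hΦ : ∀ x, constantCoeff (Φ (X x)) = 0 :=
    fun x => constantCoeff_addPolyShear_X _ (by simp [constantCoeff_X]) x
  have key : (X 3 ^ 4 + X 2 * X 3 ^ 4 + X 1 ^ 2 : R5 2) = Φ (umbrella (ZMod 2) 1 3 2 2 4) := by
    simp only [Φ, umbrella, map_add, map_mul, map_pow, addPolyShear_X_self, killVar_X,
      addPolyShear_X_of_ne _ _ (show (3 : Fin 5) ≠ 1 by decide),
      addPolyShear_X_of_ne _ _ (show (2 : Fin 5) ≠ 1 by decide),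
      show ¬ ((3 : Fin 5) = 1) by decide, if_false, CharTwo.add_sq, ← pow_mul]
    ring
  have hmax := isMaxInv_map_umbrella Φ hΦ (show (1 : Fin 5) ≠ 3 by decide)
    (show (1 : Fin 5) ≠ 2 by decide) (show (3 : Fin 5) ≠ 2 by decide) (p := 2) (m := 4)
    le_rfl (by norm_num) (by decide)
  have e : [(2 : ℚ), 5, 5] = [((2 : ℕ) : ℚ), ((4 + 1 : ℕ) : ℚ), ((4 + 1 : ℕ) : ℚ)] := by norm_num
  rw [e, key]
  exact hmax

/- Row `BERCZI#51@p3~id/q001~d2^a/q001~d3|001` (p, e) = (3, 1): `G = y2³+y2³y3+y1³`, umbrella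
`(i,j,l) = (y1,y2,y3)`, `m = 3`, word `[(y1, y2)]`, value `(3,4,4)`. -/
example :
    IsMaxInv (admissibleInvariants (X 2 ^ 3 + X 2 ^ 3 * X 3 + X 1 ^ 3 : R5 3)) [(3 : ℚ), 4, 4] := by
  let Φ : R5 3 ≃ₐ[ZMod 3] R5 3 := addPolyShear 1 (X 2)
  have hΦ : ∀ x, constantCoeff (Φ (X x)) = 0 :=
    fun x => constantCoeff_addPolyShear_X _ (by simp [constantCoeff_X]) x
  have key : (X 2 ^ 3 + X 2 ^ 3 * X 3 + X 1 ^ 3 : R5 3) = Φ (umbrella (ZMod 3) 1 2 3 3 3) := by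
    simp only [Φ, umbrella, map_add, map_mul, map_pow, addPolyShear_X_self, killVar_X,
      addPolyShear_X_of_ne _ _ (show (2 : Fin 5) ≠ 1 by decide),
      addPolyShear_X_of_ne _ _ (show (3 : Fin 5) ≠ 1 by decide),
      show ¬ ((2 : Fin 5) = 1) by decide, if_false]
    rw [add_pow_char]
    ring
  have hmax := isMaxInv_map_umbrella Φ hΦ (show (1 : Fin 5) ≠ 2 by decide)
    (show (1 : Fin 5) ≠ 3 by decide) (show (2 : Fin 5) ≠ 3 by decide) (p := 3) (m := 3)
    (by norm_num) le_rfl (by decide)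
  have e : [(3 : ℚ), 4, 4] = [((3 : ℕ) : ℚ), ((3 + 1 : ℕ) : ℚ), ((3 + 1 : ℕ) : ℚ)] := by norm_num
  rw [e, key]
  exact hmax

end Replays

end Literature.AlgebraicGeometry.Resolution.WeightedBlowup

end
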